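import Literature.MathematicalPhysics.QuantumFieldTheory.Balaban1983to89.B9Eq365QGGQFlatSymbolTransfer
import Literature.MathematicalPhysics.QuantumFieldTheory.Balaban1983to89.B9Eq349BlockDistanceWeight

/-!
# `Balaban1983to89.B9Eq349FlatDGQKernel` — T. Bałaban, *Propagators for lattice gauge theories in a background field*, Commun. Math. Phys. **99** (1985)
# 389–434 [Balaban1985BackgroundPropagators] (3.24)–(3.25) p. 394 at `U ≡ 1`, with [Balaban1983RegularityDecay] Lemma 2.4 (2.35) p. 582 and (2.48) p. 585 (on the
# torus) and [Balaban1984PropagatorsI] p. 25 («It is a translation invariant operator on the unit lattice … formula (2.48)»): **THE FLAT KERNEL OF THE CHAIN's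
# `G′(1)Q̃′†` AND OF `D_1G′(1)Q̃′†` IS b04's TORUS KERNEL `K_T` OF (2.48) — `(G′(1)Q̃′†ψ)(x) = Σ_y ρ·K_T(x̂, ŷ)•ψ(y)`, `(D_1G′(1)Q̃′†ψ)(b) = Σ_y η⁻¹ρ·(K_T(b̂₊, ŷ) −
# K_T(b̂₋, ŷ))•ψ(y)` (`ρ = (ηL)²c₁∕(c₀L^{d+1})`, hats = integer representatives) — AND IT DECAYS IN THE CHAIN's COARSE TORUS METRIC `tdist` AT b04's STRIP RATE:
# `‖K_T(x̂, ŷ)‖ ≤ M·C(κ,d)·e^{−(κ∕(d+1))·d_m(blk x, y)}` uniformly in the volume** — route R2′ STEP B8′ of the pub-balaban NE9 chain, road B8″ S1 (the flat dictionary),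
# FIRST of its three kernels (`A = D_1G′Q̃′†`; `c = (Q̃′G′²Q̃′†)⁻¹` and `B = Q̃′G′` are the sequel)

statement-level skeleton of published theorems with citation tags; proofs where landed; nothing here is a claim about the Yang–Mills mass gap

CITATION HEADER (lean-in-tree rule).  Audit cell `pub-balaban`, sub-cell `t4`, BINDER row NE9; filed by NE9 formalisation-swarm LEAF PROVER 06
(`b2b-balaban-t4-ne9-formalise-leaf-06`, gen 68) for road B8″ of `t4/ROUTES-NE9.md` v13.37 ADDENDUM (ii) (t4-ne9-idea-1 gen 100: «S1 … Bloch fibres of D, Q̃′(1), G′(1),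
c(1), Π on the coarse torus (the (viii.b) dictionary …)»; offered by name to ne9-leaf-01 ∕ ne9-leaf-06, journal 2026-08-23 l.51680; taken by leaf-06 g68 l.51909).
The two halves it joins are IN THE TREE and are used BY NAME: ne9-leaf-01's carrier dictionary (J-M-α) `B9Eq365QGGQFlatSymbolTransfer.green_component_eq_GQ`
(«the components of `G′(1)Q̃′†ψ` ARE b05's `G′Q′^*ω_w`», `B5QGGQ145Torus.GQ = Σ_y ω(y)K_T(·,y)`) with `B9Eq365QGGQFlatCarrierDictionary` (sites∕blocks∕boxes), and the
b04 cell's torus joiner `B4Torus248Decay.kernel248_torusKernel_decay_torusMetric` ([B4] (2.35) for `G_jQ_j^*` ON THE TORUS, constants depending on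
`d, a₋, a₊, m²₊` only, uniform in `j`, offset and VOLUME; `B4TorusGreen244.KT n a m² N z y := torusKernel248 n a m² (z mod n) N (⌊z∕n⌋ − y)`).  Sources READ:
[Balaban1985BackgroundPropagators] pp. 394–395 in the held text (`paper:balaban1985-cmp99-background-propagators`, journal page = PDF page + 388); [B4] p. 582,
585 and [B5′] p. 25 through the cell's audited headers (`B4Torus248Decay`, `B4TorusGreen244`, `B5QGGQ145Torus`).

THE PRINT (verbatim).  [B9] p. 394 (3.25): *«Rf = (I − G′Q′*(Q′G′²Q′*)⁻¹Q′G′)f, where G′ = G′(U) = (Δ′_a)⁻¹»*; [B5′] p. 25: *«It is a translation invariant operator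
on the unit lattice T₁^{(k)} and its Fourier transform can be written using formula (2.48) from [2].»*; [B4] p. 582 (2.35): *«|(G_j(□)Q_j^*)(x,y)|,
|(∂^{L^{−j}}_μ G_j(□)Q_j^*)(x,y)| ≤ c₀e^{−δ₀|x−y|}»*.  This file reads the chain's flat `G′(1)Q̃′†` and its covariant derivative `D_1G′(1)Q̃′†` as KERNEL operators
with b04's `K_T` as kernel, and carries [B4] (2.35)'s torus decay (the cell's crude strip rate `κ∕(d+1)`, NOT print's `δ₀`, NOT valued) over to the chain's `tdist`.

WHAT IS PROVED (sorry-free; proof lane — no `def`; [folklore] bookkeeping on landed theorems; dimension written `d+1` as in J-M-α ∕ b04).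
* §1 THE METRIC DICTIONARY: `tdist_le_torusSupNorm` (`d_m(y,y′) ≤ |ŷ − ŷ′|_{T,∞}` — in fact equal; the inequality is what decay transfer needs),
  `liftSite_blockCoord` (`(blk x)^ = ⌊x̂∕L⌋` — b04's `coarse` IS the chain's `blockCoord` on representatives), `tdist_blockCoord_le_torusSupNorm`,
  `tdist_blockCoord_bpos_btgt_le_one` (the two ends of a fine bond lie in blocks at coarse distance `≤ 1`).
* §2 THE KERNEL OF `G′(1)Q̃′†`: **`equiv_GpQadj_one_apply`** — for `η ≠ 0`, `a′ > 0` and ANY positivity witness `hpos′` of `Δ′_{a′}(1)`: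
  `(G′(1)Q̃′†ψ)(x) = Σ_{y ∈ T_m} (ρ·K_T(L, a, 0, m; x̂, ŷ))•ψ(y)`, `a = a′(ηL)²c₁∕(c₀L^{d+1})`, `ρ = (ηL)²c₁∕(c₀L^{d+1})` (`green_component_eq_GQ` tested against every
  `w ∈ W`, `ext_inner_left`; box sums = torus sums).
* §3 THE KERNEL OF `D_1G′(1)Q̃′†`: **`equiv_D_GpQadj_one_apply`** — `(D_1G′(1)Q̃′†ψ)(b) = Σ_y (η⁻¹·(ρK_T(b̂₊, ŷ) − ρK_T(b̂₋, ŷ)))•ψ(y)` (`adTransportW_one`: the flat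
  transport is the identity; (3.3) `D_1f(b) = η⁻¹(f(b₊) − f(b₋))`).
* §4 DECAY IN `tdist`: **`norm_KT_liftSite_le`** (b04's bound `‖torusKernel248 …‖ ≤ M·C·e^{−κ′|·|_{T,∞}}` at `(L, a, 0, m)` ⟹
  `‖K_T(x̂, ŷ)‖ ≤ M·C·e^{−κ′·d_m(blk x, y)}`), **`norm_flatA_le`** (the `D`-kernel: `‖η⁻¹ρ(K_T(b̂₊,ŷ) − K_T(b̂₋,ŷ))‖ ≤ ‖η⁻¹‖ρ·M·C·(e^{κ′} + 1)·e^{−κ′·d_m(blk b₋, y)}`,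
  triangle inequality over the bond), and the packaged **`exists_flatA_bound`**: from `B4Torus248Decay.kernel248_torusKernel_decay_torusMetric` — for every window
  `0 < a₋ ≤ a₊` there are `κ′ > 0`, `K ≥ 0` (depending on `d, a₋, a₊` only) such that for EVERY `L`, EVERY volume `m` and every `a ∈ [a₋, a₊]`:
  `‖K_T(L,a,0,m; x̂, ŷ)‖ ≤ K·e^{−κ′·d_m(blk x, y)}` — the entry bound `hA`∕`hB`-shape of `B9Eq349KernelConvolutionDecay.block_decay_of_conv3_kernel`.
HONEST SCOPE.  Dictionary + decay transfer for ONE of the three flat kernels of `T(1) = D_1(1 − R(1))`; the middle kernel `(Q̃′G′(1)²Q̃′†)⁻¹` (b05's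
`torusKernel145M`, `B5QGGQ145Torus.torusKernel145M_conv_qggq` against the chain's `greenK`) and the right kernel `Q̃′G′(1)` (the adjoint reading) are NOT here; no
`hτ` is concluded here; the rate is b04's crude `κ∕(d+1)` (an `∃`, `d, a₋, a₊` only) — print's `δ₀` and the lens-1 strip height `σ_Z` are NOT valued or claimed;
flat background ONLY.  NOT NE9 (cell pub-balaban: NE9 NOT PRINTED ∕ NOT PROVED; «NE9 ⇐ the named binders»; row WALLED ON A MODEL (O-NE9-1; #5 UNRULED); spine
PROVED 0∕9; rung (B)+1 on a finite T⁴ — NOT infinite volume, NOT mass gap, NOT Clay; HONEST DEPENDENCY: continuum YM on T⁴ ⇐ BetaPertH ∧ nine spine estimates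
(0/9 proved); BetaPertH ⇐ (D1) ∧ (D4) ∧ CAP+tail; G-an2-4 gates asym, D1 and NE2/3/4).  NEW file importing ne9-leaf-01's `B9Eq365QGGQFlatSymbolTransfer` (⊇ J-M-α
part 1, `B5QGGQ145Torus`, `B4TorusGreen244`, `B4Torus248Decay`) and (K2) `B9Eq349BlockDistanceWeight`; nothing modified.  Net new unproved facts: 0.
-/

noncomputable section

set_option autoImplicit false

open scoped BigOperators InnerProductSpace ComplexConjugate

namespace Literature.MathematicalPhysics.QuantumFieldTheory.Balaban1983to89.B9Eq349FlatDGQKernel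

open B4Sect5Torus (TSite tdist tdist_symm tdist_triangle tdist_nonneg circAbs_le_tdist)
open B9SectCLatticeCarrier (Bond bpos btgt)
open B9Eq311L2Pairing (WL2)
open B9Eq319QprimeTorus (fineP blockCoord)
open B11Eq103H1Complex (SiteL2K BondL2K covDerivL2K equiv_covDerivL2K)
open B9Eq33CovDerivVector (covDeriv_apply)
open B9Eq310HessianOperator (adTransportW)
open B5Eq172HodgePositivity (adTransportW_one)
open B9Eq326OperatorAssembly (QprimeW)
open B9Eq3119DeltaPiCarrier (laplacePrimeA GpOfU)
open B9Eq315QTorusOnto (liftSite perSite_liftSite)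
open B4Green244 (coarse offset)
open B4TorusPositivity (box)
open B4TorusKernel (periodConst)
open B4TorusKernel.MultiPeriod (torusSupNorm torusSupNorm_nonneg circAbs)
open B4Torus248Decay (torusKernel248 kernel248_torusKernel_decay_torusMetric)
open B4TorusGreen244 (KT)
open B5QGGQ145Torus (GQ)
open B9Eq365QGGQFlatCarrierDictionary (one_le_period sum_box_eq_sum_liftSite liftSite_mem_box liftSite_perSite_of_mem coarse_mem_box blockCoord_perSite)
open B9Eq365QGGQFlatSymbolTransfer (green_component_eq_GQ)
open B9Eq349BlockDistanceWeight (tdist_le_of_forall_le mul_tdist_blockCoord_sub_le_tdist tdist_bpos_btgt_le_one)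

variable {d : ℕ}

/-! ## §1 The metric dictionary: b04's torus sup-norm on representatives against the chain's `tdist` -/

section Metric

variable (L : ℕ) [NeZero L] (m : Fin (d + 1) → ℕ) [∀ i, NeZero (m i)]

omit [NeZero L] in
/-- **`d_m(y, y′) ≤ |ŷ − ŷ′|_{T,∞}`** (both are `max_i dist(y_i − y′_i, m_iℤ)`; the inequality suffices for decay transfer).
[cite: Balaban1983RegularityDecay, p.572 («with periodic conditions»); Balaban1985Averaging, (1) p.17] -/
theorem tdist_le_torusSupNorm (y y' : TSite (d + 1) m) : tdist m y y' ≤ torusSupNorm m (liftSite y - liftSite y') := by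
  have hN : ∀ i, 1 ≤ m i := one_le_period m
  refine tdist_le_of_forall_le hN y y' (torusSupNorm_nonneg hN _) fun i => ?_
  have e : (liftSite y - liftSite y') i = ((y i : ℕ) : ℤ) - ((y' i : ℕ) : ℤ) := rfl
  have h := Finset.le_sup' (fun j => ((circAbs (m j) ((liftSite y - liftSite y') j) : ℤ) : ℝ)) (Finset.mem_univ i)
  rw [e] at h
  exact h

/-- **b04's `coarse` IS the chain's `blockCoord` on representatives**: `(blk x)^ = ⌊x̂∕L⌋`. [cite: Balaban1985Averaging, (2) p.17; Balaban1983RegularityDecay, (1.4)–(1.5) p.572] -/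
theorem liftSite_blockCoord [∀ i, NeZero (fineP L m i)] (x : TSite (d + 1) (fineP L m)) :
    liftSite (blockCoord L m x) = coarse L (liftSite x) := by
  have h := blockCoord_perSite L m (liftSite x)
  rw [perSite_liftSite] at h
  rw [h, liftSite_perSite_of_mem m (coarse_mem_box L m (liftSite_mem_box _ x))]

/-- hence `d_m(blk x, y) ≤ |⌊x̂∕L⌋ − ŷ|_{T,∞}` — the argument of b04's decay bound for `K_T(x̂, ŷ)`. [cite: Balaban1983RegularityDecay, (2.48) p.585 with p.572] -/
theorem tdist_blockCoord_le_torusSupNorm [∀ i, NeZero (fineP L m i)] (x : TSite (d + 1) (fineP L m)) (y : TSite (d + 1) m) :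
    tdist m (blockCoord L m x) y ≤ torusSupNorm m (coarse L (liftSite x) - liftSite y) := by
  rw [← liftSite_blockCoord L m x]
  exact tdist_le_torusSupNorm m _ _

/-- **the two ends of a fine bond lie in blocks at coarse distance `≤ 1`**. [cite: Balaban1985Averaging, (2) p.17; Balaban1985BackgroundPropagators, (3.49) p.399] -/
theorem tdist_blockCoord_bpos_btgt_le_one (b : Bond (d + 1) (fineP L m)) :
    tdist m (blockCoord L m (bpos b)) (blockCoord L m (btgt b)) ≤ 1 := by
  have hm : ∀ i, 1 ≤ m i := one_le_period m
  have hL : 1 ≤ L := Nat.one_le_iff_ne_zero.mpr (NeZero.ne L)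
  have hP : ∀ i, 1 ≤ fineP L m i := fun i => Nat.one_le_iff_ne_zero.mpr (Nat.mul_ne_zero (by omega) (by have := hm i; omega))
  have h1 := mul_tdist_blockCoord_sub_le_tdist (L := L) hm (bpos b) (btgt b)
  have h2 := tdist_bpos_btgt_le_one hP b
  have hL' : (1 : ℝ) ≤ L := by exact_mod_cast hL
  have hL0 : (0 : ℝ) < L := by linarith
  have h3 : (L : ℝ) * tdist m (blockCoord L m (bpos b)) (blockCoord L m (btgt b)) ≤ (L : ℝ) * 1 := by linarith
  exact le_of_mul_le_mul_left h3 hL0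

end Metric

/-! ## §2 The kernel of the flat `G′(1)Q̃′†` is b04's `K_T` -/

section Kernel

variable (L : ℕ) [NeZero L] (m : Fin (d + 1) → ℕ) [∀ i, NeZero (m i)] [∀ i, NeZero (fineP L m i)]
  {𝔸 : Type*} [Ring 𝔸] [Algebra ℂ 𝔸] {W : Type*} [NormedAddCommGroup W] [InnerProductSpace ℂ W] [FiniteDimensional ℂ W]
  (φ : W ≃ₗ[ℂ] 𝔸) (c₀ : ℝ) [Fact (0 < c₀)] (η : ℝ) (c₁ : ℝ) [Fact (0 < c₁)]

/-- **THE KERNEL OF `G′(1)Q̃′†`**: `(G′(1)Q̃′†ψ)(x) = Σ_{y ∈ T_m} (ρ·K_T(L, a, 0, m; x̂, ŷ))•ψ(y)`, `a = a′(ηL)²c₁∕(c₀L^{d+1})`, `ρ = (ηL)²c₁∕(c₀L^{d+1})` — for ANY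
positivity witness `hpos′` of `Δ′_{a′}(1)`. [cite: Balaban1985BackgroundPropagators, (3.24)–(3.25) p.394; Balaban1984PropagatorsI, p.25; Balaban1983RegularityDecay, (2.48) p.585] -/
theorem equiv_GpQadj_one_apply (hη : η ≠ 0) {a' : ℝ} (ha' : 0 < a')
    (hpos' : ∀ x : SiteL2K ℂ (d + 1) (fineP L m) c₀ W, x ≠ 0 →
      0 < RCLike.re ⟪x, laplacePrimeA L m φ η (fun _ : Bond (d + 1) (fineP L m) => (1 : 𝔸ˣ)) a' (c₁ := c₁) x⟫_ℂ)
    (ψ : SiteL2K ℂ (d + 1) m c₁ W) (x : TSite (d + 1) (fineP L m)) :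
    WL2.equiv ℂ _ W (GpOfU L m φ η (fun _ : Bond (d + 1) (fineP L m) => (1 : 𝔸ˣ)) a' (c₁ := c₁) hpos'
        (LinearMap.adjoint ((WL2.linearEquiv ℂ ℂ (fun _ : TSite (d + 1) m => c₁)).symm.toLinearMap ∘ₗ
          QprimeW L m φ (fun _ : Bond (d + 1) (fineP L m) => (1 : 𝔸ˣ)) (c₀ := c₀)) ψ)) x =
      ∑ y : TSite (d + 1) m, (((((η * L) ^ 2 * (c₁ / (c₀ * (L : ℝ) ^ (d + 1)))) : ℝ) : ℂ) *
        KT L (a' * (η * L) ^ 2 * (c₁ / (c₀ * (L : ℝ) ^ (d + 1)))) 0 m (liftSite x) (liftSite y)) • WL2.equiv ℂ _ W ψ y := by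
  apply ext_inner_left ℂ
  intro w
  have h := congrFun (green_component_eq_GQ L m φ c₀ η c₁ hη ha' hpos' ψ w) (liftSite x)
  simp only [perSite_liftSite] at h
  rw [h, GQ, sum_box_eq_sum_liftSite m, inner_sum]
  refine Finset.sum_congr rfl fun y _ => ?_
  rw [perSite_liftSite, inner_smul_right]
  ring

/-! ## §3 The kernel of the flat `D_1G′(1)Q̃′†` -/

/-- **THE KERNEL OF `D_1G′(1)Q̃′†`**: `(D_1G′(1)Q̃′†ψ)(b) = Σ_y (η⁻¹·(ρK_T(b̂₊, ŷ) − ρK_T(b̂₋, ŷ)))•ψ(y)` — the flat transport is the identity ((3.3) at `U ≡ 1`).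
[cite: Balaban1985BackgroundPropagators, (3.3) p.390, (3.25) p.394; Balaban1983RegularityDecay, (2.35) p.582] -/
theorem equiv_D_GpQadj_one_apply (hη : η ≠ 0) {a' : ℝ} (ha' : 0 < a')
    (hpos' : ∀ x : SiteL2K ℂ (d + 1) (fineP L m) c₀ W, x ≠ 0 →
      0 < RCLike.re ⟪x, laplacePrimeA L m φ η (fun _ : Bond (d + 1) (fineP L m) => (1 : 𝔸ˣ)) a' (c₁ := c₁) x⟫_ℂ)
    (ψ : SiteL2K ℂ (d + 1) m c₁ W) (b : Bond (d + 1) (fineP L m)) :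
    WL2.equiv ℂ _ W (covDerivL2K ℂ c₀ ((η : ℂ))⁻¹ (adTransportW φ (fun _ : Bond (d + 1) (fineP L m) => (1 : 𝔸ˣ)))
        (GpOfU L m φ η (fun _ : Bond (d + 1) (fineP L m) => (1 : 𝔸ˣ)) a' (c₁ := c₁) hpos'
          (LinearMap.adjoint ((WL2.linearEquiv ℂ ℂ (fun _ : TSite (d + 1) m => c₁)).symm.toLinearMap ∘ₗ
            QprimeW L m φ (fun _ : Bond (d + 1) (fineP L m) => (1 : 𝔸ˣ)) (c₀ := c₀)) ψ))) b =
      ∑ y : TSite (d + 1) m, (((η : ℂ))⁻¹ *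
        (((((η * L) ^ 2 * (c₁ / (c₀ * (L : ℝ) ^ (d + 1)))) : ℝ) : ℂ) *
            KT L (a' * (η * L) ^ 2 * (c₁ / (c₀ * (L : ℝ) ^ (d + 1)))) 0 m (liftSite (btgt b)) (liftSite y) -
          ((((η * L) ^ 2 * (c₁ / (c₀ * (L : ℝ) ^ (d + 1)))) : ℝ) : ℂ) *
            KT L (a' * (η * L) ^ 2 * (c₁ / (c₀ * (L : ℝ) ^ (d + 1)))) 0 m (liftSite (bpos b)) (liftSite y))) • WL2.equiv ℂ _ W ψ y := by
  rw [equiv_covDerivL2K, covDeriv_apply, adTransportW_one, LinearMap.id_apply]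
  rw [equiv_GpQadj_one_apply L m φ c₀ η c₁ hη ha' hpos' ψ (btgt b), equiv_GpQadj_one_apply L m φ c₀ η c₁ hη ha' hpos' ψ (bpos b),
    ← Finset.sum_sub_distrib, Finset.smul_sum]
  refine Finset.sum_congr rfl fun y _ => ?_
  rw [← sub_smul, smul_smul]

end Kernel

/-! ## §4 Decay of the flat kernels in the chain's coarse torus metric -/

section Decay

variable (L : ℕ) [NeZero L] (m : Fin (d + 1) → ℕ) [∀ i, NeZero (m i)] [∀ i, NeZero (fineP L m i)]

/-- **`K_T` READ ON THE CHAIN's SITES DECAYS IN `tdist`**: b04's bound `‖torusKernel248 L a 0 τ m v‖ ≤ M·C·e^{−κ′·|v|_{T,∞}}` (all offsets `τ`, all `v`) gives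
`‖K_T(L,a,0,m; x̂, ŷ)‖ ≤ M·C·e^{−κ′·d_m(blk x, y)}` (`K_T(z,y) = torusKernel248(z mod L; ⌊z∕L⌋ − y)`, §1). [cite: Balaban1983RegularityDecay, Lemma 2.4 (2.35) p.582, (2.48) p.585] -/
theorem norm_KT_liftSite_le {a MC κ' : ℝ} (hκ' : 0 ≤ κ')
    (hb : ∀ (τ : Fin (d + 1) → Fin L) (v : Fin (d + 1) → ℤ), ‖torusKernel248 L a 0 τ m v‖ ≤ MC * Real.exp (-(κ' * torusSupNorm m v)))
    (x : TSite (d + 1) (fineP L m)) (y : TSite (d + 1) m) :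
    ‖KT L a 0 m (liftSite x) (liftSite y)‖ ≤ MC * Real.exp (-(κ' * tdist m (blockCoord L m x) y)) := by
  have h := hb (offset L (liftSite x)) (coarse L (liftSite x) - liftSite y)
  have hMC : 0 ≤ MC := le_of_mul_le_mul_right (by rw [zero_mul]; exact (norm_nonneg _).trans h) (Real.exp_pos _)
  refine (show ‖KT L a 0 m (liftSite x) (liftSite y)‖ ≤ MC * Real.exp (-(κ' * torusSupNorm m (coarse L (liftSite x) - liftSite y))) from h).trans ?_
  refine mul_le_mul_of_nonneg_left (Real.exp_le_exp.mpr ?_) hMC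
  have := tdist_blockCoord_le_torusSupNorm L m x y
  nlinarith

omit [∀ i, NeZero (fineP L m i)] in
/-- **THE `D`-KERNEL's DECAY**: `‖η⁻¹(ρK_T(b̂₊,ŷ) − ρK_T(b̂₋,ŷ))‖ ≤ ‖η⁻¹‖·ρ·MC·(e^{κ′} + 1)·e^{−κ′·d_m(blk b₋, y)}` (`0 ≤ ρ`; the `b₊`-term through
`d_m(blk b₊, y) ≥ d_m(blk b₋, y) − 1`). [cite: Balaban1983RegularityDecay, Lemma 2.4 (2.35) p.582; Balaban1985BackgroundPropagators, (3.49) p.399] -/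
theorem norm_flatA_le {a MC κ' ρ : ℝ} (hκ' : 0 ≤ κ') (hρ : 0 ≤ ρ) (η : ℝ)
    (hb : ∀ (τ : Fin (d + 1) → Fin L) (v : Fin (d + 1) → ℤ), ‖torusKernel248 L a 0 τ m v‖ ≤ MC * Real.exp (-(κ' * torusSupNorm m v)))
    (b : Bond (d + 1) (fineP L m)) (y : TSite (d + 1) m) :
    ‖((η : ℂ))⁻¹ * (((ρ : ℝ) : ℂ) * KT L a 0 m (liftSite (btgt b)) (liftSite y) - ((ρ : ℝ) : ℂ) * KT L a 0 m (liftSite (bpos b)) (liftSite y))‖ ≤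
      ‖((η : ℂ))⁻¹‖ * ρ * MC * (Real.exp κ' + 1) * Real.exp (-(κ' * tdist m (blockCoord L m (bpos b)) y)) := by
  have hm : ∀ i, 1 ≤ m i := one_le_period m
  have hplus := norm_KT_liftSite_le L m hκ' hb (btgt b) y
  have hminus := norm_KT_liftSite_le L m hκ' hb (bpos b) y
  have hMC : 0 ≤ MC := le_of_mul_le_mul_right (by rw [zero_mul]; exact (norm_nonneg _).trans hminus) (Real.exp_pos _)
  -- the `b₊` block is within coarse distance 1 of the `b₋` block
  have htri : tdist m (blockCoord L m (bpos b)) y ≤ 1 + tdist m (blockCoord L m (btgt b)) y := by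
    linarith [tdist_triangle hm (blockCoord L m (bpos b)) (blockCoord L m (btgt b)) y, tdist_blockCoord_bpos_btgt_le_one L m b]
  have hexp : Real.exp (-(κ' * tdist m (blockCoord L m (btgt b)) y)) ≤ Real.exp κ' * Real.exp (-(κ' * tdist m (blockCoord L m (bpos b)) y)) := by
    rw [← Real.exp_add]
    exact Real.exp_le_exp.mpr (by nlinarith)
  have hρn : ‖((ρ : ℝ) : ℂ)‖ = ρ := by rw [Complex.norm_real, Real.norm_eq_abs, abs_of_nonneg hρ]
  have hinner : ‖((ρ : ℝ) : ℂ) * KT L a 0 m (liftSite (btgt b)) (liftSite y) - ((ρ : ℝ) : ℂ) * KT L a 0 m (liftSite (bpos b)) (liftSite y)‖ ≤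
      ρ * MC * (Real.exp κ' + 1) * Real.exp (-(κ' * tdist m (blockCoord L m (bpos b)) y)) :=
    calc ‖((ρ : ℝ) : ℂ) * KT L a 0 m (liftSite (btgt b)) (liftSite y) - ((ρ : ℝ) : ℂ) * KT L a 0 m (liftSite (bpos b)) (liftSite y)‖
        ≤ ‖((ρ : ℝ) : ℂ) * KT L a 0 m (liftSite (btgt b)) (liftSite y)‖ + ‖((ρ : ℝ) : ℂ) * KT L a 0 m (liftSite (bpos b)) (liftSite y)‖ :=
          norm_sub_le _ _
      _ = ρ * ‖KT L a 0 m (liftSite (btgt b)) (liftSite y)‖ + ρ * ‖KT L a 0 m (liftSite (bpos b)) (liftSite y)‖ := by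
          rw [norm_mul, norm_mul, hρn]
      _ ≤ ρ * (MC * (Real.exp κ' * Real.exp (-(κ' * tdist m (blockCoord L m (bpos b)) y)))) +
            ρ * (MC * Real.exp (-(κ' * tdist m (blockCoord L m (bpos b)) y))) :=
          add_le_add (mul_le_mul_of_nonneg_left (hplus.trans (mul_le_mul_of_nonneg_left hexp hMC)) hρ)
            (mul_le_mul_of_nonneg_left hminus hρ)
      _ = ρ * MC * (Real.exp κ' + 1) * Real.exp (-(κ' * tdist m (blockCoord L m (bpos b)) y)) := by ring
  rw [norm_mul]
  calc ‖((η : ℂ))⁻¹‖ * ‖((ρ : ℝ) : ℂ) * KT L a 0 m (liftSite (btgt b)) (liftSite y) - ((ρ : ℝ) : ℂ) * KT L a 0 m (liftSite (bpos b)) (liftSite y)‖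
      ≤ ‖((η : ℂ))⁻¹‖ * (ρ * MC * (Real.exp κ' + 1) * Real.exp (-(κ' * tdist m (blockCoord L m (bpos b)) y))) :=
        mul_le_mul_of_nonneg_left hinner (norm_nonneg _)
    _ = ‖((η : ℂ))⁻¹‖ * ρ * MC * (Real.exp κ' + 1) * Real.exp (-(κ' * tdist m (blockCoord L m (bpos b)) y)) := by ring

omit [NeZero L] [∀ i, NeZero (m i)] [∀ i, NeZero (fineP L m i)] in
/-- **THE PACKAGE (b04's [B4] (2.35) on the torus, BY NAME)**: for every penalty window `0 < a₋ ≤ a ≤ a₊` there are `κ′ > 0` and `K ≥ 0`, depending on `d, a₋, a₊`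
ONLY, such that for EVERY block size `L`, EVERY volume `m` and every `a` in the window: `‖K_T(L,a,0,m; x̂, ŷ)‖ ≤ K·e^{−κ′·d_m(blk x, y)}` — the entry-bound shape
(`hA`∕`hB`) of `B9Eq349KernelConvolutionDecay.block_decay_of_conv3_kernel`, uniformly in the volume. [cite: Balaban1983RegularityDecay, Lemma 2.4 (2.35) p.582 («c₀e^{−δ₀|x−y|}»), (2.48) p.585; Balaban1984PropagatorsI, p.25] -/
theorem exists_flatA_bound (aminus aplus : ℝ) (ha : 0 < aminus) :
    ∃ κ' K : ℝ, 0 < κ' ∧ 0 ≤ K ∧ ∀ (L : ℕ) [NeZero L] (m : Fin (d + 1) → ℕ) [∀ i, NeZero (m i)] [∀ i, NeZero (fineP L m i)] (a : ℝ),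
      aminus ≤ a → a ≤ aplus → ∀ (x : TSite (d + 1) (fineP L m)) (y : TSite (d + 1) m),
        ‖KT L a 0 m (liftSite x) (liftSite y)‖ ≤ K * Real.exp (-(κ' * tdist m (blockCoord L m x) y)) := by
  obtain ⟨κ, M, hκ, hM, h⟩ := kernel248_torusKernel_decay_torusMetric d aminus aplus 0 ha
  have hC : 0 ≤ periodConst κ d := by
    unfold periodConst
    refine pow_nonneg (div_nonneg (by positivity) ?_) _
    have hκ' : (0 : ℝ) < κ / (d + 1) := by positivity
    have h1 : Real.exp (-(κ / (d + 1))) < 1 := Real.exp_lt_one_iff.mpr (by linarith)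
    linarith
  refine ⟨κ / (d + 1), M * periodConst κ d, by positivity, mul_nonneg hM hC, fun L _ m _ _ a ha1 ha2 x y => ?_⟩
  have hm : ∀ i, 1 ≤ m i := one_le_period m
  exact norm_KT_liftSite_le L m (by positivity) (fun τ v => h L a 0 ha1 ha2 le_rfl le_rfl τ m hm v) x y

end Decay

end Literature.MathematicalPhysics.QuantumFieldTheory.Balaban1983to89.B9Eq349FlatDGQKernel

end
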